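import Summits.CriticalPhenomena.CardyFormulaZ2.Theorems.CardyFlipRussoSquareFromVoronoiHubProductLegDefs
import Mathlib.Analysis.Convex.Segment
import HarnessLib

/-!
# The two diagonals of every face of the jittered square lattice cross — stub
# `stub_faceDiagonalsCross` of line `SketchIdeator5R2` for crux `SquareFromVoronoiHub`
# (stmt-CriticalPhenomena-6434, route CardyFlipRusso, sub-problem CardyFormulaZ2)

For a jitter field `ξ : ℤ × ℤ → ℂ` with `‖ξ v‖ ≤ a ≤ 1/20` and the jittered corners `A` (SW),
`B` (SE), `C` (NE), `D` (NW) of a lattice face, the open segments `(A, C)` and `(B, D)` meet.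
Proof: solve `A + s (C - A) = B + t (D - B)` for real `s, t` by Cramer's rule (a `2 × 2` system
with columns `C - A ≈ (1, 1)`, `B - D ≈ (1, -1)`, determinant `≥ 81/50`); the numerators lie in
`[7/10, 33/25]`, so `0 < s, t < 1`.  Planar algebra only; no named facts are used.
-/

noncomputable section

namespace Summit.CriticalPhenomena.CardyFormulaZ2.Cruxes.SquareFromVoronoiHub.ProductLeg

namespace stub_faceDiagonalsCrossAux

/-- **Cramer core.**  For a real `2 × 2` system `s U - t V = W` whose columns `U`, `-V` are
entrywise within `1/10` of `(1, 1)`, `(1, -1)` and whose right-hand side `W` is within `1/10` of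
`(1, 0)`, the solution satisfies `0 < s < 1` and `0 < t < 1` (determinant `≥ 81/50`, numerators
in `[7/10, 33/25]`). [folklore] -/
theorem cross_core {U₁ U₂ V₁ V₂ W₁ W₂ : ℝ}
    (hU₁ : 9 / 10 ≤ U₁ ∧ U₁ ≤ 11 / 10) (hU₂ : 9 / 10 ≤ U₂ ∧ U₂ ≤ 11 / 10)
    (hV₁ : 9 / 10 ≤ -V₁ ∧ -V₁ ≤ 11 / 10) (hV₂ : 9 / 10 ≤ V₂ ∧ V₂ ≤ 11 / 10)
    (hW₁ : 9 / 10 ≤ W₁ ∧ W₁ ≤ 11 / 10) (hW₂ : -(1 / 10) ≤ W₂ ∧ W₂ ≤ 1 / 10) :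
    ∃ s t : ℝ, 0 < s ∧ s < 1 ∧ 0 < t ∧ t < 1 ∧
      s * U₁ - t * V₁ = W₁ ∧ s * U₂ - t * V₂ = W₂ := by
  -- determinant `U₁ V₂ - U₂ V₁ ≥ 81/50`
  have p₁ : 0 ≤ (U₁ - 9 / 10) * (V₂ - 9 / 10) := mul_nonneg (by linarith) (by linarith)
  have p₂ : 0 ≤ (U₂ - 9 / 10) * (-V₁ - 9 / 10) := mul_nonneg (by linarith) (by linarith)
  have hd : 81 / 50 ≤ U₁ * V₂ - U₂ * V₁ := by linarith
  have hd0 : 0 < U₁ * V₂ - U₂ * V₁ := by linarith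
  -- numerator of `s`: `W₁ V₂ - W₂ V₁ ∈ [7/10, 33/25]`
  have p₃ : 0 ≤ (W₁ - 9 / 10) * (V₂ - 9 / 10) := mul_nonneg (by linarith) (by linarith)
  have p₄ : 0 ≤ (11 / 10 - W₁) * (V₂ - 9 / 10) := mul_nonneg (by linarith) (by linarith)
  have p₅ : 0 ≤ -V₁ * (1 / 10 + W₂) := mul_nonneg (by linarith) (by linarith)
  have p₆ : 0 ≤ -V₁ * (1 / 10 - W₂) := mul_nonneg (by linarith) (by linarith)
  have hs_lo : 7 / 10 ≤ W₁ * V₂ - W₂ * V₁ := by linarith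
  have hs_hi : W₁ * V₂ - W₂ * V₁ ≤ 33 / 25 := by linarith
  -- numerator of `t`: `U₂ W₁ - U₁ W₂ ∈ [7/10, 33/25]`
  have p₇ : 0 ≤ (U₂ - 9 / 10) * (W₁ - 9 / 10) := mul_nonneg (by linarith) (by linarith)
  have p₈ : 0 ≤ (11 / 10 - U₂) * (W₁ - 9 / 10) := mul_nonneg (by linarith) (by linarith)
  have p₉ : 0 ≤ U₁ * (1 / 10 + W₂) := mul_nonneg (by linarith) (by linarith)
  have p₁₀ : 0 ≤ U₁ * (1 / 10 - W₂) := mul_nonneg (by linarith) (by linarith)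
  have ht_lo : 7 / 10 ≤ U₂ * W₁ - U₁ * W₂ := by linarith
  have ht_hi : U₂ * W₁ - U₁ * W₂ ≤ 33 / 25 := by linarith
  refine ⟨(W₁ * V₂ - W₂ * V₁) / (U₁ * V₂ - U₂ * V₁),
    (U₂ * W₁ - U₁ * W₂) / (U₁ * V₂ - U₂ * V₁),
    div_pos (by linarith) hd0, (div_lt_one hd0).2 (by linarith), div_pos (by linarith) hd0,
    (div_lt_one hd0).2 (by linarith), ?_, ?_⟩
  · rw [div_mul_eq_mul_div, div_mul_eq_mul_div, ← sub_div, div_eq_iff hd0.ne']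
    ring
  · rw [div_mul_eq_mul_div, div_mul_eq_mul_div, ← sub_div, div_eq_iff hd0.ne']
    ring

/-- **Crossing diagonals, complex form.**  For four points `A = p + e_A`, `B = p + 1 + e_B`,
`C = p + (1 + i) + e_C`, `D = p + i + e_D` with `‖e_·‖ ≤ a ≤ 1/20` (the jittered corners SW, SE,
NE, NW of a unit lattice face with SW corner `p`), the open segments `(A, C)` and `(B, D)` have a
common point `X = (1 - s) A + s C = (1 - t) B + t D`, `0 < s, t < 1`. [folklore] -/
theorem cross_complex {a : ℝ} (ha : a ≤ 1 / 20) {p A B C D eA eB eC eD : ℂ}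
    (hA : A = p + eA) (hB : B = p + 1 + eB) (hC : C = p + (1 + Complex.I) + eC)
    (hD : D = p + Complex.I + eD)
    (heA : ‖eA‖ ≤ a) (heB : ‖eB‖ ≤ a) (heC : ‖eC‖ ≤ a) (heD : ‖eD‖ ≤ a) :
    ∃ X : ℂ, X ∈ openSegment ℝ A C ∧ X ∈ openSegment ℝ B D := by
  have hre : ∀ e : ℂ, ‖e‖ ≤ a → -a ≤ e.re ∧ e.re ≤ a := fun e he =>
    abs_le.1 ((Complex.abs_re_le_norm e).trans he)
  have him : ∀ e : ℂ, ‖e‖ ≤ a → -a ≤ e.im ∧ e.im ≤ a := fun e he =>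
    abs_le.1 ((Complex.abs_im_le_norm e).trans he)
  obtain ⟨hA₁, hA₁'⟩ := hre eA heA
  obtain ⟨hA₂, hA₂'⟩ := him eA heA
  obtain ⟨hB₁, hB₁'⟩ := hre eB heB
  obtain ⟨hB₂, hB₂'⟩ := him eB heB
  obtain ⟨hC₁, hC₁'⟩ := hre eC heC
  obtain ⟨hC₂, hC₂'⟩ := him eC heC
  obtain ⟨hD₁, hD₁'⟩ := hre eD heD
  obtain ⟨hD₂, hD₂'⟩ := him eD heD
  -- the `2 × 2` system for `X = A + s (C - A) = B + t (D - B)` in coordinates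
  obtain ⟨s, t, hs0, hs1, ht0, ht1, h1, h2⟩ :=
    cross_core (U₁ := 1 + eC.re - eA.re) (U₂ := 1 + eC.im - eA.im) (V₁ := -1 + eD.re - eB.re)
      (V₂ := 1 + eD.im - eB.im) (W₁ := 1 + eB.re - eA.re) (W₂ := eB.im - eA.im)
      ⟨by linarith, by linarith⟩ ⟨by linarith, by linarith⟩ ⟨by linarith, by linarith⟩
      ⟨by linarith, by linarith⟩ ⟨by linarith, by linarith⟩ ⟨by linarith, by linarith⟩
  refine ⟨(1 - s) • A + s • C, ⟨1 - s, s, by linarith, hs0, by ring, rfl⟩,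
    ⟨1 - t, t, by linarith, ht0, by ring, ?_⟩⟩
  rw [hA, hB, hC, hD]
  apply Complex.ext
  · simp only [Complex.add_re, Complex.smul_re, smul_eq_mul, Complex.one_re, Complex.I_re]
    linear_combination -h1
  · simp only [Complex.add_im, Complex.smul_im, smul_eq_mul, Complex.one_im, Complex.I_im]
    linear_combination -h2

end stub_faceDiagonalsCrossAux

open stub_faceDiagonalsCrossAux in
/-- **stub_faceDiagonalsCross** (endpoint law (viii) of line `SketchIdeator5R2`): for jitter
amplitude `0 ≤ a ≤ 1/20` and jitters `‖ξ v‖ ≤ a`, in every face of the jittered square lattice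
`ℤ² + ξ` — corners `A = sqPos v + ξ v` (SW), `B` (SE), `C` (NE), `D` (NW) — the two diagonals
CROSS: the open segments `(A, C)` and `(B, D)` have a common point (so two Delaunay diagonals of a
face are concyclic by `stub_crossingDelaunay_cospherical`).  The common point is
`A + s (C - A) = B + t (D - B)` with `s, t ∈ (0, 1)` from Cramer's rule. [folklore] -/
theorem stub_faceDiagonalsCross :
    ∀ (a : ℝ) (ξ : ℤ × ℤ → ℂ), 0 ≤ a → a ≤ 1 / 20 → (∀ v, ‖ξ v‖ ≤ a) → ∀ v : ℤ × ℤ,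
      ∃ X : ℂ, X ∈ openSegment ℝ (sqPos v + ξ v)
          (sqPos (v.1 + 1, v.2 + 1) + ξ (v.1 + 1, v.2 + 1)) ∧
        X ∈ openSegment ℝ (sqPos (v.1 + 1, v.2) + ξ (v.1 + 1, v.2))
          (sqPos (v.1, v.2 + 1) + ξ (v.1, v.2 + 1)) := by
  intro a ξ _ ha hξ v
  refine cross_complex ha (p := sqPos v) rfl ?_ ?_ ?_ (hξ v) (hξ (v.1 + 1, v.2))
    (hξ (v.1 + 1, v.2 + 1)) (hξ (v.1, v.2 + 1))
  · simp only [sqPos]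
    push_cast
    ring
  · simp only [sqPos]
    push_cast
    ring
  · simp only [sqPos]
    push_cast
    ring

end Summit.CriticalPhenomena.CardyFormulaZ2.Cruxes.SquareFromVoronoiHub.ProductLeg

end
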